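import Summits.CriticalPhenomena.PercolationContinuityZ3.Theorems.PercNearOneGluingNoHeavyQuantGateMoveBlobGeneralWitness
import HarnessLib

/-!
# QUANT lane R8, the graded-closure programme G₀ (lead g37 RULING V364), light half: a two-layer row of (gated BLOB) ∗ μ from ONE
# top-low-capacity row of μ at the layer BELOW the product threshold — tilt-free, weight one, any blob size, any gate

builds on p205010 (kernel theorem, internal audit signed; external expert review pending)

Support file (`--supports stmt-CriticalPhenomena-4575`), QUANT lane seat prim-quant-census-2 (gen 65), rung R8 of
`run/shared/lean/prim/quant/LADDER.md`.  Theorems with standard axioms, no sorries, default heartbeats.  Companion of `…QuantDepthOneRelayRow`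
(census-2 g64: the relay partner `{0: 1−y, 1: y}`, factor row at layer `k = ⌈T + y − d⌉`, depth `T − 2d ≥ 1`).  Census memo:
`run/shared/lean/prim/quant/prim-quant-census-2-g65/G0-BLOB-G65.md`.

THE STATEMENT.  Floor `0 < y < 1`, `u = y/(1−y)`; a law `μ ≥ 0` (the big factor) with a target `T`; a blob partner `{0: 1−g, m: g}` with ANY gate
`0 ≤ g ≤ 1` and ANY size `m`; the product `ν(n) = (1−g)·μ(n) + g·μ(n−m)` has target `T + g·m`.  Fix a product threshold `d` (in G₀ a low of the factor, `2d < T`, so that the factor row below is one of its TLC rows; the first theorem does not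
even need that) and let `k` be an integer with `k < T + g·m − d + 1` (the product's giant threshold `⌈T + g·m − d⌉` is the intended value).
**`LawDec.blobConv_twoLayerRow_of_tlcRow`:** IF `μ` satisfies the single top-low-capacity row `(j, i′) = (k−1, d)` at floor `y`, target `T` on `{0..M}`
— `u·μ{≤ d} ≤ μ{k..M} + u·Σ_{h ≤ k−1, T < d+h} μ(h)/usage y T (k−1) d h` — AND the blob's gate pays the mid rate on the (at most `m`) mids `h` of
that row with `k ≤ h + m` — `u ≤ g·usage y T (k−1) d h` — THEN the two-layer row `d` of `ν` at target `T + g·m` holds in expanded form: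
`u·((1−g)·μ{≤ d} + g·μ{≤ d−m}) ≤ (1−g)·μ{k ≤ n ≤ M} + g·μ{k−m ≤ n ≤ M}`.
**`LawDec.blobConv_twoLayerRow_of_tlcRow_deep`:** the rate hypothesis is automatic on DEEP rows, `u·m ≤ T − 2d` (via `heavy_le_usage`:
`usage ≥ (T−2d)/(d+h−T)` and `d + h − T < g·m` for every mid below `k`).
PROOF (three lines, no pointwise certificate needed).  (1) Every mid `h ≤ k−1` of the factor row has `h + m ≥ k` (else `h < T − d − m(1−g) ≤ T − d`),
so by the rate hypothesis `u·μ(h)/usage ≤ g·μ(h)`, and the factor row gives `u·μ{≤d} ≤ μ{≥k} + g·Σ_{mids} μ(h)`; (2) the mids lie in `[k−m, k−1]`, so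
`μ{≥k} + g·Σ_{mids} μ ≤ (1−g)·μ{≥k} + g·μ{≥ k−m}` (`μ ≥ 0`); (3) `μ{≤ d−m} ≤ μ{≤ d}`, so the left side is at most `u·μ{≤d}`.  ∎
WHAT IT SAYS FOR G₀ (`LawDec.TLCGateConvTLB`, census-2 g64 ⧗ p376703) at `q = 1`: for a blob partner every product two-layer row whose threshold is a
factor low of depth `T − 2d ≥ u·m` follows from ONE depth-1 row of the big factor with weight one and NO mean tilt — for every gate `g`, interior
or top-affordability-tight.  For the relay (`m = 1`) this weakens `…QuantDepthOneRelayRow`'s depth hypothesis `T − 2d ≥ 1` to `T − 2d ≥ u` (`u < 1` in the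
light half), reads the factor row one layer lower (`k−1` instead of `k`, so no rate condition at `h = k`), and removes the interior-gate tilt of
`gateRelayConv_twoLayerRow_of_tlcRow`.  EXACT CHECK (census-2 g65, `code/g0blob/phi_check.py`): the pointwise form of the certificate is valid in
347 982 / 347 982 cells exactly when the rate hypothesis holds (0 mismatches; `y ∈ {1/10,…,49/100}`, `m ∈ {1,2,3,4,6}`, six gates per `y` incl. `g = y`
and `g = 99/100`, `M ≤ 40`, seven targets per `M`, every admissible `d`), and the deep-row condition `u·m ≤ T − 2d` implies it in 303 201 / 303 201.
The shallow rows (`T − 2d < u·m`) are where the LP certificate uses a second factor row and/or tilts (census-2 g64 memo §6/§6c).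

[this work]; usage / flows: prim-quant-stmt g22 (`LawDec.usage`), `heavy_le_usage`: this lane; the tensor principle whose one-row instance this is:
prim-quant-arm-2 g38 (`twoLayer_pair_of_certificate`).  Nothing here is cited as a published result.  The gluing rows served
[cite: KozmaNitzan2024, Conjecture 3 (p. 15)]; product measure [cite: Grimmett1999, §1.3 p. 10].
-/

noncomputable section

namespace Summit.CriticalPhenomena.PercolationContinuityZ3.Theorems

namespace Quant

open Finset

namespace LawDec

/-- **G₀ FOR A BLOB PARTNER, ONE ROW AT A TIME, AT THE LAYER BELOW THE PRODUCT THRESHOLD (census-2 g65).**  `0 < y < 1`, `0 ≤ g ≤ 1`, `μ ≥ 0`;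
a target `T`, a threshold `d`, an integer `k < T + g·m − d + 1` (no depth hypothesis: `2d < T` is only where the factor row is a hypothesis of G₀).  If `μ` satisfies the top-low-capacity row `(k−1, d)` at floor `y`,
target `T` on `{0..M}`, and the blob's gate pays the mid rate (`y/(1−y) ≤ g·usage y T (k−1) d h`) on every mid `h ≤ k−1`, `T < d + h`, `k ≤ h + m`,
then the two-layer row `d` of `ν = (1−g)μ + g·μ(· − m)` with giant threshold `k` holds:
`y/(1−y)·((1−g)·Σ_{n ≤ d} μ n + g·Σ_{n ≤ d−m} μ n) ≤ (1−g)·Σ_{n ≤ M}[k ≤ n] μ n + g·Σ_{n ≤ M}[k ≤ n+m] μ n`. [this work] -/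
theorem blobConv_twoLayerRow_of_tlcRow (y g T : ℝ) (M m d k : ℕ) (μ : ℕ → ℝ)
    (hy0 : 0 < y) (hy1 : y < 1) (hg0 : 0 ≤ g) (hg1 : g ≤ 1) (hμ0 : ∀ h, 0 ≤ μ h)
    (hk : (k : ℝ) < T + g * m - d + 1)
    (hrow : y / (1 - y) * ∑ l ∈ Finset.range (d + 1), μ l
      ≤ ∑ h ∈ Finset.range (M + 1), (if k ≤ h then μ h else 0)
        + y / (1 - y) * ∑ h ∈ Finset.range (M + 1),
            (if h + 1 ≤ k ∧ T < (d : ℝ) + h then μ h / usage y T (k - 1) d h else 0))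
    (hrate : ∀ h : ℕ, T < (d : ℝ) + h → h + 1 ≤ k → k ≤ h + m → y / (1 - y) ≤ g * usage y T (k - 1) d h) :
    y / (1 - y) * ((1 - g) * ∑ n ∈ Finset.range (d + 1), μ n + g * ∑ n ∈ Finset.range (d + 1 - m), μ n)
      ≤ (1 - g) * ∑ n ∈ Finset.range (M + 1), (if k ≤ n then μ n else 0)
        + g * ∑ n ∈ Finset.range (M + 1), (if k ≤ n + m then μ n else 0) := by
  have h1y : 0 < 1 - y := by linarith
  set u : ℝ := y / (1 - y) with hu
  have hu0 : 0 < u := div_pos hy0 h1y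
  have hgm : g * (m : ℝ) ≤ m := mul_le_of_le_one_left (Nat.cast_nonneg m) hg1
  -- every mid of the factor row lies within `m` of the threshold
  have hmid : ∀ h : ℕ, T < (d : ℝ) + h → h + 1 ≤ k → k ≤ h + m := by
    intro h hcomp hhk
    by_contra hc
    have hc' : h + m + 1 ≤ k := by omega
    have hc'' : (h : ℝ) + m + 1 ≤ k := by exact_mod_cast hc'
    linarith
  -- (1) the capacity terms are paid by the blob's gate: u·μ(h)/usage ≤ g·μ(h)
  have hcap : u * ∑ h ∈ Finset.range (M + 1),
        (if h + 1 ≤ k ∧ T < (d : ℝ) + h then μ h / usage y T (k - 1) d h else 0)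
      ≤ g * ∑ h ∈ Finset.range (M + 1), (if h + 1 ≤ k ∧ T < (d : ℝ) + h then μ h else 0) := by
    rw [Finset.mul_sum, Finset.mul_sum]
    refine Finset.sum_le_sum fun h _ => ?_
    by_cases hc : h + 1 ≤ k ∧ T < (d : ℝ) + h
    · rw [if_pos hc, if_pos hc]
      have hr := hrate h hc.2 hc.1 (hmid h hc.2 hc.1)
      have hus : 0 < usage y T (k - 1) d h := by
        rcases lt_or_ge 0 (usage y T (k - 1) d h) with hpos | hle
        · exact hpos
        · exfalso
          nlinarith [mul_nonpos_iff.2 (Or.inl ⟨hg0, hle⟩)]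
      rw [mul_div_assoc', div_le_iff₀ hus]
      nlinarith [mul_le_mul_of_nonneg_left hr (hμ0 h)]
    · rw [if_neg hc, if_neg hc, mul_zero, mul_zero]
  -- (2) giants of the shifted copy contain the giants AND the mids of the factor row
  have hshift : ∑ n ∈ Finset.range (M + 1), (if k ≤ n then μ n else 0)
        + ∑ n ∈ Finset.range (M + 1), (if n + 1 ≤ k ∧ T < (d : ℝ) + n then μ n else 0)
      ≤ ∑ n ∈ Finset.range (M + 1), (if k ≤ n + m then μ n else 0) := by
    rw [← Finset.sum_add_distrib]
    refine Finset.sum_le_sum fun n _ => ?_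
    by_cases h1 : k ≤ n
    · have e1 : ¬ (n + 1 ≤ k ∧ T < (d : ℝ) + n) := fun hc => absurd hc.1 (by omega)
      have e2 : k ≤ n + m := by omega
      rw [if_pos h1, if_neg e1, if_pos e2, add_zero]
    · rw [if_neg h1, zero_add]
      by_cases h2 : n + 1 ≤ k ∧ T < (d : ℝ) + n
      · rw [if_pos h2, if_pos (hmid n h2.2 h2.1)]
      · rw [if_neg h2]
        split_ifs
        · exact hμ0 n
        · exact le_rfl
  -- (3) the shifted copy's low mass is at most the low mass
  have hsub : ∑ n ∈ Finset.range (d + 1 - m), μ n ≤ ∑ n ∈ Finset.range (d + 1), μ n :=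
    Finset.sum_le_sum_of_subset_of_nonneg (Finset.range_mono (Nat.sub_le (d + 1) m)) fun n _ _ => hμ0 n
  -- assemble
  have hL : u * ((1 - g) * ∑ n ∈ Finset.range (d + 1), μ n + g * ∑ n ∈ Finset.range (d + 1 - m), μ n)
      ≤ u * ∑ n ∈ Finset.range (d + 1), μ n := by
    refine mul_le_mul_of_nonneg_left ?_ hu0.le
    nlinarith [mul_le_mul_of_nonneg_left hsub hg0]
  refine le_trans hL (le_trans hrow ?_)
  nlinarith [mul_le_mul_of_nonneg_left hshift hg0, hcap]

/-- **DEEP ROWS NEED NO RATE HYPOTHESIS (census-2 g65).**  In `blobConv_twoLayerRow_of_tlcRow`, if the product threshold `d` has depth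
`y/(1−y)·m ≤ T − 2d` in the big factor, the blob's gate pays the mid rate automatically: for a mid `h ≤ k−1` one has `0 < d + h − T < g·m`
and `usage ≥ (T − 2d)/(d + h − T)` (`heavy_le_usage`), so `g·usage ≥ g(T−2d)/(g·m) ≥ y/(1−y)`.  Hence the two-layer row `d` of
`(1−g)μ + g·μ(· − m)` follows from the single top-low-capacity row `(k−1, d)` of `μ`, for every gate `0 ≤ g ≤ 1` and every blob size `m`. [this work] -/
theorem blobConv_twoLayerRow_of_tlcRow_deep (y g T : ℝ) (M m d k : ℕ) (μ : ℕ → ℝ)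
    (hy0 : 0 < y) (hy1 : y < 1) (hg0 : 0 ≤ g) (hg1 : g ≤ 1) (hμ0 : ∀ h, 0 ≤ μ h)
    (hlow : 2 * (d : ℝ) < T) (hdeep : y / (1 - y) * m ≤ T - 2 * (d : ℝ)) (hk : (k : ℝ) < T + g * m - d + 1)
    (hrow : y / (1 - y) * ∑ l ∈ Finset.range (d + 1), μ l
      ≤ ∑ h ∈ Finset.range (M + 1), (if k ≤ h then μ h else 0)
        + y / (1 - y) * ∑ h ∈ Finset.range (M + 1),
            (if h + 1 ≤ k ∧ T < (d : ℝ) + h then μ h / usage y T (k - 1) d h else 0)) :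
    y / (1 - y) * ((1 - g) * ∑ n ∈ Finset.range (d + 1), μ n + g * ∑ n ∈ Finset.range (d + 1 - m), μ n)
      ≤ (1 - g) * ∑ n ∈ Finset.range (M + 1), (if k ≤ n then μ n else 0)
        + g * ∑ n ∈ Finset.range (M + 1), (if k ≤ n + m then μ n else 0) := by
  have h1y : 0 < 1 - y := by linarith
  have hu0 : 0 < y / (1 - y) := div_pos hy0 h1y
  refine blobConv_twoLayerRow_of_tlcRow y g T M m d k μ hy0 hy1 hg0 hg1 hμ0 hk hrow ?_
  intro h hcomp hhk _
  have hhk' : h ≤ k - 1 := by omega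
  have hH := heavy_le_usage y T (k - 1) d h hy0 hy1 hhk' hlow hcomp
  -- 0 < d + h − T < g·m
  have hpos : 0 < (d : ℝ) + h - T := by linarith
  have hhk1 : (h : ℝ) + 1 ≤ k := by exact_mod_cast hhk
  have hlt : (d : ℝ) + h - T < g * m := by linarith
  -- y/(1−y)·(d+h−T) ≤ y/(1−y)·g·m ≤ g·(T−2d), then divide and use `usage ≥ (T−2d)/(d+h−T)`
  have h1 : y / (1 - y) * ((d : ℝ) + h - T) ≤ g * (T - 2 * (d : ℝ)) := by
    have : y / (1 - y) * ((d : ℝ) + h - T) ≤ y / (1 - y) * (g * m) := mul_le_mul_of_nonneg_left hlt.le hu0.le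
    nlinarith [mul_le_mul_of_nonneg_left hdeep hg0]
  calc y / (1 - y) ≤ g * ((T - 2 * (d : ℝ)) / ((d : ℝ) + h - T)) := by
        rw [mul_div_assoc', le_div_iff₀ hpos]; exact h1
    _ ≤ g * usage y T (k - 1) d h := mul_le_mul_of_nonneg_left hH hg0

/-! ### Appendix (census-2 g65, same session): the gate phantom rides along — the certificate has yield exactly one -/

/-- **THE GATED VERSION FOR FREE (census-2 g65).**  Same statement as `blobConv_twoLayerRow_of_tlcRow` with an arbitrary constant `c` added to
the low side of BOTH the factor row and the conclusion: because the proof uses the factor row exactly once with weight one, any slack in the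
hypothesis is inherited verbatim.  With `c = y/(1−y)·(1−q)/q` (and `T` := the gated target `q·T₁`) the hypothesis is the top-low-capacity row of the
GATED big factor `gate μ q` (its phantom zero `1−q` is a low atom) divided by `q`, and the conclusion is the two-layer row `d` of the GATED product
`gate (μ ∗ blob) q` divided by `q` — so for blob partners the deep rows of G₀ (`LawDec.TLCGateConvTLB`) hold at EVERY gate `0 < q ≤ 1`, not only at
`q = 1`, with no phantom design (contrast: the heavy node's general rows needed arm-1 g42's removal lemma ♯). [this work] -/
theorem blobConv_twoLayerRow_of_tlcRow_slack (y g T c : ℝ) (M m d k : ℕ) (μ : ℕ → ℝ)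
    (hy0 : 0 < y) (hy1 : y < 1) (hg0 : 0 ≤ g) (hg1 : g ≤ 1) (hμ0 : ∀ h, 0 ≤ μ h)
    (hk : (k : ℝ) < T + g * m - d + 1)
    (hrow : y / (1 - y) * ∑ l ∈ Finset.range (d + 1), μ l + c
      ≤ ∑ h ∈ Finset.range (M + 1), (if k ≤ h then μ h else 0)
        + y / (1 - y) * ∑ h ∈ Finset.range (M + 1),
            (if h + 1 ≤ k ∧ T < (d : ℝ) + h then μ h / usage y T (k - 1) d h else 0))
    (hrate : ∀ h : ℕ, T < (d : ℝ) + h → h + 1 ≤ k → k ≤ h + m → y / (1 - y) ≤ g * usage y T (k - 1) d h) :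
    y / (1 - y) * ((1 - g) * ∑ n ∈ Finset.range (d + 1), μ n + g * ∑ n ∈ Finset.range (d + 1 - m), μ n) + c
      ≤ (1 - g) * ∑ n ∈ Finset.range (M + 1), (if k ≤ n then μ n else 0)
        + g * ∑ n ∈ Finset.range (M + 1), (if k ≤ n + m then μ n else 0) := by
  have h1y : 0 < 1 - y := by linarith
  set u : ℝ := y / (1 - y) with hu
  have hu0 : 0 < u := div_pos hy0 h1y
  have hgm : g * (m : ℝ) ≤ m := mul_le_of_le_one_left (Nat.cast_nonneg m) hg1
  have hmid : ∀ h : ℕ, T < (d : ℝ) + h → h + 1 ≤ k → k ≤ h + m := by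
    intro h hcomp hhk
    by_contra hc
    have hc' : h + m + 1 ≤ k := by omega
    have hc'' : (h : ℝ) + m + 1 ≤ k := by exact_mod_cast hc'
    linarith
  have hcap : u * ∑ h ∈ Finset.range (M + 1),
        (if h + 1 ≤ k ∧ T < (d : ℝ) + h then μ h / usage y T (k - 1) d h else 0)
      ≤ g * ∑ h ∈ Finset.range (M + 1), (if h + 1 ≤ k ∧ T < (d : ℝ) + h then μ h else 0) := by
    rw [Finset.mul_sum, Finset.mul_sum]
    refine Finset.sum_le_sum fun h _ => ?_
    by_cases hc : h + 1 ≤ k ∧ T < (d : ℝ) + h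
    · rw [if_pos hc, if_pos hc]
      have hr := hrate h hc.2 hc.1 (hmid h hc.2 hc.1)
      have hus : 0 < usage y T (k - 1) d h := by
        rcases lt_or_ge 0 (usage y T (k - 1) d h) with hpos | hle
        · exact hpos
        · exfalso
          nlinarith [mul_nonpos_iff.2 (Or.inl ⟨hg0, hle⟩)]
      rw [mul_div_assoc', div_le_iff₀ hus]
      nlinarith [mul_le_mul_of_nonneg_left hr (hμ0 h)]
    · rw [if_neg hc, if_neg hc, mul_zero, mul_zero]
  have hshift : ∑ n ∈ Finset.range (M + 1), (if k ≤ n then μ n else 0)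
        + ∑ n ∈ Finset.range (M + 1), (if n + 1 ≤ k ∧ T < (d : ℝ) + n then μ n else 0)
      ≤ ∑ n ∈ Finset.range (M + 1), (if k ≤ n + m then μ n else 0) := by
    rw [← Finset.sum_add_distrib]
    refine Finset.sum_le_sum fun n _ => ?_
    by_cases h1 : k ≤ n
    · have e1 : ¬ (n + 1 ≤ k ∧ T < (d : ℝ) + n) := fun hc => absurd hc.1 (by omega)
      have e2 : k ≤ n + m := by omega
      rw [if_pos h1, if_neg e1, if_pos e2, add_zero]
    · rw [if_neg h1, zero_add]
      by_cases h2 : n + 1 ≤ k ∧ T < (d : ℝ) + n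
      · rw [if_pos h2, if_pos (hmid n h2.2 h2.1)]
      · rw [if_neg h2]
        split_ifs
        · exact hμ0 n
        · exact le_rfl
  have hsub : ∑ n ∈ Finset.range (d + 1 - m), μ n ≤ ∑ n ∈ Finset.range (d + 1), μ n :=
    Finset.sum_le_sum_of_subset_of_nonneg (Finset.range_mono (Nat.sub_le (d + 1) m)) fun n _ _ => hμ0 n
  have hL : u * ((1 - g) * ∑ n ∈ Finset.range (d + 1), μ n + g * ∑ n ∈ Finset.range (d + 1 - m), μ n)
      ≤ u * ∑ n ∈ Finset.range (d + 1), μ n := by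
    refine mul_le_mul_of_nonneg_left ?_ hu0.le
    nlinarith [mul_le_mul_of_nonneg_left hsub hg0]
  nlinarith [mul_le_mul_of_nonneg_left hshift hg0, hcap, hL, hrow]

end LawDec

end Quant

end Summit.CriticalPhenomena.PercolationContinuityZ3.Theorems
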